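import Summits.ValiantsHypothesis.ValiantsHypothesis.Theorems.BarrierLeverSuccinctHittingSetsForVPWinWin
import Summits.ValiantsHypothesis.ValiantsHypothesis.Theorems.BarrierLeverIntegerBoxVanishingTransfer
import Summits.ValiantsHypothesis.ValiantsHypothesis.Theses.BarrierLever

/-!
# Route BarrierLever — item `NaturalProofsSeparateVNP` (stmt-ValiantsHypothesis-18972):
# LEVEL REDUCTION for separating natural proofs, and the CKRST-type door on the coefficient axis

Helper file (`--supports stmt-ValiantsHypothesis-18972`; cell val-lit, NP corpus, seat val-lit-p1).
Closes NO item.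

Item 18972 asks for LEVEL-ONE natural proofs (distinguishers of size and degree `≤ N = C(2n,n)`)
against `SmallCircuits ℂ n b` for every `b`, infinitely often, each nonzero at some member of the
`VNP`-succinct class `SmallDefinable ℂ n b₁` (one `b₁` for all `b`). A published construction of
equations for `VP` — Chatterjee–Kumar–Ramya–Saptharishi–Tengse 2020, Thm 1.1 — delivers
distinguishers of size and degree `poly(N)`, i.e. of SOME level `a`, and vanishing only on the
`{-1,0,1}`-coefficient (by their remark: `|coeff| ≤ N`, bit-length LINEAR in `n`) members of `VP`.
This file records exactly how far such a construction is from the item: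

* §1 `levelOne_of_level` / `naturalProofsSeparateVNP_iff_level`: the level is IRRELEVANT — separating
  natural proofs of any level `a ≥ 1` (with definable non-roots, exponent `b₁`) give level-one ones
  with the SAME `b₁`, by the padding `n ↦ 3n` of the landed level collapse
  (`…SuccinctHittingSetsForVP.LevelOne`, `stub_restrict`) plus the closure of `SmallDefinable` under
  zero-padding of variables (`boolSum_rename_sumMap`). So item 18972 ⟺ its level-`a` form, every `a ≥ 1`.
* §2 `naturalProofsSeparateVNP_of_intBoxProofs`: by the CLOSED item 20033
  (`IntSlice.integerBoxVanishingTransfer`), it suffices that the level-`a` distinguishers vanish on the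
  members of `SmallCircuits ℂ n (5b+23)` with INTEGER coefficients of absolute value
  `≤ IntSlice.bnd n b (N^a (n+1))` (bit-length QUADRATIC in `n`) — and have a definable non-root.
  `signCoeffSlice_subset_intBox`: CKRST's printed slice lies inside that box, so their vanishing
  statement is the WEAKER one; the door is "linear → quadratic bit-length" (plus a definable non-root),
  not a citation.

Related landed glue (cite, not restated here): `…Theorems.BarrierLever.NPCorpusChain` (lead-np:
`naturalProofsSeparateVNP_of_not_crux`, `not_crux_of_naturalProofsSeparateVNP`, …),
`…Theorems.BarrierLever.NaturalProofsSeparateVNP` in `…NaturalProofsSeparateVNPLinks` (this seat: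
`naturalProofsSeparateVNP_iff_vanishing_nonRoot`, `krstForVP_iff_not_naturalProofsSeparateVNP`, …) and
in `…NaturalProofsSeparateVNPStatus` (val-np-p4: `valiantsHypothesis_of_naturalProofsSeparateVNP`, …).

WHAT THIS IS NOT: item 18972 stays OPEN (under hardness of the permanent it is the negation of FSV
Question 6); no CKRST theorem is formalised or assumed here; `VP ≠ VNP` is not proved and nothing
here is progress on it.

References: [ChatterjeeKumarRamyaSaptharishiTengse2020] Thm 1.1 and the remark after it;
[ForbesShpilkaVolk2018] Def. 1, Cor. 5, Question 6, Lemmas 13–14; [KumarRamyaSaptharishiTengse2022] §1.2.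
-/

-- layout Summits/ValiantsHypothesis/ValiantsHypothesis forces the duplicated namespace component
set_option linter.dupNamespace false

namespace Summit.ValiantsHypothesis.ValiantsHypothesis.Theorems.BarrierLever.NaturalProofsSeparateVNP

open MvPolynomial Literature.Barriers.ValiantsHypothesis Literature.Computability.AlgebraicComplexity
open Summit.ValiantsHypothesis.ValiantsHypothesis.Theorems.BarrierLever.SuccinctHittingSetsForVP

/-! ### §0 Monotonicity and padding bookkeeping -/

/-- The distinguisher classes grow with the level (`N = C(2n,n) ≥ 1`). [cite: ForbesShpilkaVolk2018, Cor. 5] -/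
theorem distinguishers_mono {n a a' : ℕ} (h : a ≤ a') : Distinguishers ℂ n a ⊆ Distinguishers ℂ n a' := by
  intro D hD
  have hN : 1 ≤ Nat.choose (2 * n) n := Nat.choose_pos (by omega)
  exact ⟨hD.1.trans (Nat.pow_le_pow_right hN h), hD.2.trans (Nat.pow_le_pow_right hN h)⟩

/-- A natural proof stays one after enlarging the distinguisher class. [cite: ForbesShpilkaVolk2018, Def. 1] -/
theorem isNaturalProof_mono {n b : ℕ} {𝒟 𝒟' : Set (MvPolynomial (degLEMonomials n) ℂ)} (h : 𝒟 ⊆ 𝒟')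
    {D : MvPolynomial (degLEMonomials n) ℂ}
    (hD : IsNaturalProof (degLEMonomials n) (SmallCircuits ℂ n b) 𝒟 D) :
    IsNaturalProof (degLEMonomials n) (SmallCircuits ℂ n b) 𝒟' D :=
  ⟨h hD.1, hD.2.1, hD.2.2⟩

/-- **`SmallDefinable` is closed under zero-padding of the variables** (`Fin n ↪ Fin n'`, same
exponent): rename the Boolean-summed auxiliary along `Sum.map (Fin.castLE h) id`
(`boolSum_rename_sumMap`); complexity and degree do not grow under `rename`, and `n^b₁ ≤ n'^b₁`.
[cite: KumarRamyaSaptharishiTengse2022, Def. 3] -/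
theorem rename_mem_smallDefinable {n n' b₁ : ℕ} (h : n ≤ n') {g : MvPolynomial (Fin n) ℂ}
    (hg : g ∈ SmallDefinable ℂ n b₁) : rename (Fin.castLE h) g ∈ SmallDefinable ℂ n' b₁ := by
  obtain ⟨hdeg, u, hu, G, hGc, hGd, rfl⟩ := hg
  have hpow : n ^ b₁ ≤ n' ^ b₁ := Nat.pow_le_pow_left h b₁
  refine ⟨(totalDegree_rename_le _ _).trans (hdeg.trans h), u, hu.trans hpow,
    rename (Sum.map (Fin.castLE h) id) G, (complexity_rename_le_holds' _ G).trans (hGc.trans hpow),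
    (totalDegree_rename_le _ _).trans (hGd.trans hpow), (boolSum_rename_sumMap _ G).symm⟩

/-- The coefficient vector of the padded polynomial, read on the padded monomials, is the original
coefficient vector. [cite: ForbesShpilkaVolk2018, Def. 1] -/
theorem coeffVector_rename_comp_pad {n n' : ℕ} (h : n ≤ n') (g : MvPolynomial (Fin n) ℂ) :
    coeffVector (degLEMonomials n') (rename (Fin.castLE h) g) ∘ (LevelOne.mapsTo_pad h).restrict _ _ _ =
      coeffVector (degLEMonomials n) g := by
  funext m
  simp only [Function.comp_apply, coeffVector_apply, Set.MapsTo.val_restrict_apply]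
  exact coeff_rename_mapDomain _ (Fin.castLE_injective h) g m

/-! ### §1 Level reduction: separating natural proofs of level `a + 1` give level `a` (same `b₁`) -/

/-- **The padding step `a + 1 ⇒ a`** (`a ≥ 1`) for SEPARATING natural proofs with definable
non-roots: pad the level-`(a+1)` distinguisher `D` at `n` variables to `3n` variables (it becomes
level `a`, `LevelOne.rename_pad_mem_distinguishers`); it vanishes on `SmallCircuits ℂ (3n) b` because
every such `f'` shadows back to some `f ∈ SmallCircuits ℂ n b'` with the same coefficients on the
padded monomials (`stub_restrict`), where `D` vanishes; and the padded non-root `rename (Fin.castLE _) g`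
stays in `SmallDefinable ℂ (3n) b₁`. [cite: ForbesShpilkaVolk2018, Cor. 5 and Question 6] -/
theorem level_pred {a b₁ : ℕ} (ha : 1 ≤ a)
    (h : ∀ b n₀ : ℕ, ∃ n : ℕ, n₀ ≤ n ∧
      ∃ D, IsNaturalProof (degLEMonomials n) (SmallCircuits ℂ n b) (Distinguishers ℂ n (a + 1)) D ∧
        ∃ g ∈ SmallDefinable ℂ n b₁, eval (coeffVector (degLEMonomials n) g) D ≠ 0) :
    ∀ b n₀ : ℕ, ∃ n : ℕ, n₀ ≤ n ∧
      ∃ D, IsNaturalProof (degLEMonomials n) (SmallCircuits ℂ n b) (Distinguishers ℂ n a) D ∧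
        ∃ g ∈ SmallDefinable ℂ n b₁, eval (coeffVector (degLEMonomials n) g) D ≠ 0 := by
  intro b n₀
  obtain ⟨b', n₁, hb'⟩ := stub_restrict b
  obtain ⟨n, hn, D, ⟨hD, hD0, hvan⟩, g, hg, hne⟩ := h b' (n₀ + n₁ + 3)
  have hn3 : 3 ≤ n := by omega
  have h3 : n ≤ 3 * n := by omega
  refine ⟨3 * n, by omega, rename ((LevelOne.mapsTo_pad h3).restrict _ _ _) D, ⟨?_, ?_, ?_⟩,
    rename (Fin.castLE h3) g, rename_mem_smallDefinable h3 hg, ?_⟩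
  · exact LevelOne.rename_pad_mem_distinguishers hn3 ha h3 hD
  · exact fun h0 => hD0 (rename_injective _ (LevelOne.restrict_pad_injective h3) (by rw [h0, map_zero]))
  · intro f' hf'
    obtain ⟨f, hf, hcoeff⟩ := hb' n (by omega) (3 * n) h3 le_rfl f' hf'
    have hvec : coeffVector (degLEMonomials n) f =
        coeffVector (degLEMonomials (3 * n)) f' ∘ (LevelOne.mapsTo_pad h3).restrict _ _ _ := by
      funext m
      simp only [coeffVector_apply, Function.comp_apply, Set.MapsTo.val_restrict_apply]
      exact hcoeff m m.2
    rw [eval_rename, ← hvec]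
    exact hvan f hf
  · rw [eval_rename, coeffVector_rename_comp_pad]
    exact hne

/-- **Every level `a` reduces to level one** (same `b₁`): induction on `a` by `level_pred`; level `0`
distinguishers are level-one distinguishers. [cite: ForbesShpilkaVolk2018, Question 6] -/
theorem levelOne_of_level : ∀ (a : ℕ) {b₁ : ℕ},
    (∀ b n₀ : ℕ, ∃ n : ℕ, n₀ ≤ n ∧
      ∃ D, IsNaturalProof (degLEMonomials n) (SmallCircuits ℂ n b) (Distinguishers ℂ n a) D ∧
        ∃ g ∈ SmallDefinable ℂ n b₁, eval (coeffVector (degLEMonomials n) g) D ≠ 0) →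
    WinWin.NaturalProofsSeparate b₁
  | 0, _, h => fun b n₀ => by
      obtain ⟨n, hn, D, hD, hg⟩ := h b n₀
      exact ⟨n, hn, D, isNaturalProof_mono (distinguishers_mono zero_le_one) hD, hg⟩
  | 1, _, h => h
  | a + 2, _, h => levelOne_of_level (a + 1) (level_pred (by omega) h)

/-- Conversely level one is every level `a ≥ 1` (monotonicity of the distinguisher class).
[cite: ForbesShpilkaVolk2018, Cor. 5] -/
theorem level_of_levelOne {a b₁ : ℕ} (ha : 1 ≤ a) (h : WinWin.NaturalProofsSeparate b₁) :
    ∀ b n₀ : ℕ, ∃ n : ℕ, n₀ ≤ n ∧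
      ∃ D, IsNaturalProof (degLEMonomials n) (SmallCircuits ℂ n b) (Distinguishers ℂ n a) D ∧
        ∃ g ∈ SmallDefinable ℂ n b₁, eval (coeffVector (degLEMonomials n) g) D ≠ 0 := by
  intro b n₀
  obtain ⟨n, hn, D, hD, hg⟩ := h b n₀
  exact ⟨n, hn, D, isNaturalProof_mono (distinguishers_mono ha) hD, hg⟩

/-- **Item 18972 from separating natural proofs of ANY level**: `poly(N)`-size, `poly(N)`-degree
distinguishers (level `a`) vanishing on `SmallCircuits ℂ n b` for every `b`, infinitely often, each
with a non-root in `SmallDefinable ℂ n b₁`, give the item (level one, same `b₁`).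
[cite: ForbesShpilkaVolk2018, Question 6] -/
theorem naturalProofsSeparateVNP_of_level (a : ℕ)
    (h : ∃ b₁ : ℕ, ∀ b n₀ : ℕ, ∃ n : ℕ, n₀ ≤ n ∧
      ∃ D, IsNaturalProof (degLEMonomials n) (SmallCircuits ℂ n b) (Distinguishers ℂ n a) D ∧
        ∃ g ∈ SmallDefinable ℂ n b₁, eval (coeffVector (degLEMonomials n) g) D ≠ 0) :
    Theses.BarrierLever.NaturalProofsSeparateVNP := by
  obtain ⟨b₁, hb₁⟩ := h
  exact ⟨b₁, levelOne_of_level a hb₁⟩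

/-- **Item 18972 is equivalent to its level-`a` form, for every `a ≥ 1`.**
[cite: ForbesShpilkaVolk2018, Question 6] -/
theorem naturalProofsSeparateVNP_iff_level {a : ℕ} (ha : 1 ≤ a) :
    Theses.BarrierLever.NaturalProofsSeparateVNP ↔
      ∃ b₁ : ℕ, ∀ b n₀ : ℕ, ∃ n : ℕ, n₀ ≤ n ∧
        ∃ D, IsNaturalProof (degLEMonomials n) (SmallCircuits ℂ n b) (Distinguishers ℂ n a) D ∧
          ∃ g ∈ SmallDefinable ℂ n b₁, eval (coeffVector (degLEMonomials n) g) D ≠ 0 :=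
  ⟨fun ⟨b₁, hb₁⟩ => ⟨b₁, level_of_levelOne ha hb₁⟩, naturalProofsSeparateVNP_of_level a⟩

/-! ### §2 The coefficient-axis door (CKRST-type constructions) -/

/-- **The integer-box door to item 18972.** By the CLOSED item 20033
(`IntSlice.integerBoxVanishingTransfer` / `IntSlice.vanishes_of_vanishes_on_intBox`), a level-`a`
distinguisher vanishing on the members of `SmallCircuits ℂ n (5b+23)` whose coefficients are INTEGERS
of absolute value `≤ IntSlice.bnd n b (N^a (n+1))` (bit-length `O(a n² + b n log n)`) vanishes on all
of `SmallCircuits ℂ n b`. Hence: one exponent `b₁` and, for every `b`, infinitely often (at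
`n ≥ 21876·2^(5b+21)+1`), such a box-vanishing level-`a` distinguisher with a non-root in
`SmallDefinable ℂ n b₁` give item 18972. [cite: ForbesShpilkaVolk2018, Lemmas 13–14] -/
theorem naturalProofsSeparateVNP_of_intBoxProofs (a : ℕ)
    (h : ∃ b₁ : ℕ, ∀ b n₀ : ℕ, ∃ n : ℕ, n₀ ≤ n ∧ 21876 * 2 ^ (5 * b + 21) + 1 ≤ n ∧
      ∃ D ∈ Distinguishers ℂ n a,
        (∀ f ∈ SmallCircuits ℂ n (5 * b + 23),
          f ∈ IntSlice.intBox n (IntSlice.bnd n b ((Nat.choose (2 * n) n) ^ a * (n + 1))) →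
            eval (coeffVector (degLEMonomials n) f) D = 0) ∧
        ∃ g ∈ SmallDefinable ℂ n b₁, eval (coeffVector (degLEMonomials n) g) D ≠ 0) :
    Theses.BarrierLever.NaturalProofsSeparateVNP := by
  obtain ⟨b₁, hb₁⟩ := h
  refine naturalProofsSeparateVNP_of_level a ⟨b₁, fun b n₀ => ?_⟩
  obtain ⟨n, hn, hbig, D, hD, hvan, g, hg, hne⟩ := hb₁ b n₀
  have hD0 : D ≠ 0 := by rintro rfl; simp at hne
  exact ⟨n, hn, D, ⟨hD, hD0, IntSlice.vanishes_of_vanishes_on_intBox hbig hD hvan⟩, g, hg, hne⟩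

/-- **CKRST's printed slice is inside the box**: `{-1,0,1}`-coefficient polynomials
(`signCoeffSlice n`, Chatterjee–Kumar–Ramya–Saptharishi–Tengse 2020 Thm 1.1) lie in every integer box
of bound `≥ 1`. So "vanishing on the sign-slice members of `SmallCircuits`" (what CKRST Thm 1.1
provides, for every size exponent) is WEAKER than the box-vanishing hypothesis of
`naturalProofsSeparateVNP_of_intBoxProofs`: the printed theorem does not reach item 18972 by citation;
the open step on the coefficient axis is linear (print: `|coeff| ≤ N`) versus quadratic bit-length.
[cite: ChatterjeeKumarRamyaSaptharishiTengse2020, Thm 1.1] -/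
theorem signCoeffSlice_subset_intBox (n : ℕ) {B : ℕ} (hB : 1 ≤ B) :
    signCoeffSlice (F := ℂ) n ⊆ IntSlice.intBox n B := by
  intro f hf m
  rcases hf m with h0 | h1 | hm1
  · exact ⟨0, by simp [h0], by simp⟩
  · exact ⟨1, by simp [h1], by simpa using hB⟩
  · exact ⟨-1, by simp [hm1], by simpa using hB⟩

/-- In particular a distinguisher vanishing on the box-members of `SmallCircuits ℂ n b'` vanishes on
its sign-slice members (the converse is the open step). [cite: ChatterjeeKumarRamyaSaptharishiTengse2020, Thm 1.1] -/
theorem vanishes_on_signSlice_of_vanishes_on_intBox {n b' B : ℕ} (hB : 1 ≤ B)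
    {D : MvPolynomial (degLEMonomials n) ℂ}
    (hvan : ∀ f ∈ SmallCircuits ℂ n b', f ∈ IntSlice.intBox n B →
      eval (coeffVector (degLEMonomials n) f) D = 0) :
    ∀ f ∈ SmallCircuits ℂ n b', f ∈ signCoeffSlice (F := ℂ) n →
      eval (coeffVector (degLEMonomials n) f) D = 0 :=
  fun f hf hfs => hvan f hf (signCoeffSlice_subset_intBox n hB hfs)

end Summit.ValiantsHypothesis.ValiantsHypothesis.Theorems.BarrierLever.NaturalProofsSeparateVNP
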